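import Literature.NumberTheory.EllipticCurves.Kato2004.IwasawaH1LayerEigenfunctionalZetaTwoProofs
import Literature.NumberTheory.EllipticCurves.CuspFormTwistRatPlusSymbol
import Literature.NumberTheory.Automorphic.ShimuraCurveRibetTakahashiPeterssonTwistComparisonProofs
import HarnessLib

/-!
# Kato 2004, Thm. 12.5 (1) for the PAIR `(f_W, f_{W′})`, `W′ = W^{(−1)}`, at `p = 2`: the `ψ`-weighted value of the
# transported datum `i·x′` (odd character `ψ·χ₄` of `f′`) and of `x` (even character `ψ` of `f_W`) are PROPORTIONAL by ONE
# complex constant — `L(f′, ψχ₄, s) = L(f_W, ψ, s)` and Kato's guarded datum (THEOREMS ONLY)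

Topic `NumberTheory/EllipticCurves`, sub-directory `Kato2004` (namespace = path). THEOREMS ONLY (no `def`, no named fact, no
instance). Cell `bsd-2adic` (run/shared/lean/pub/bsd-2adic/), seat `bsd-2adic-addL2x` GEN 21 (crux stmt-BirchSwinnertonDyer-19098
`AdditiveRankZeroAtTwo`, child C4″ stmt-BirchSwinnertonDyer-22618; repair-census entry R-B84 (1): the ODD-BRANCH side of reading step
T22 (b) of the descent sockets). HONEST FRAMING: nothing about BSD or Kato's Main Conjecture is claimed; the statements are
CONDITIONAL on two `ZetaBody` witnesses `(W, f, κ, Λ, x)` and `(W′, f′, κ′, Λ′, x′)` over one guarded datum `(c, d, a | a′, A)`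
(the pair construction fact `exists_eulerSystem_expStar_values_negOneTwistPair_two` produces them).

## The computation (Kato Thm. 12.5 (1) twice; socket docstring T22 (b))

Fix a level `M = 2^{n+2}` (`cycLevel 2 (n+2) ∅`), the package embedding `ι = ι_M : ℚ(ζ_M) → ℂ`, `i_M ∈ ℚ(ζ_M)` with
`ι(i_M) = I`, and an EVEN `ℚ(ζ_M)`-valued Dirichlet character `ψ` mod `M` with complex shadow `ψ_ℂ = ψ ∘ ι`. Put
`ξ := Σ_b ψ(b) σ_b(x_{n+2,∅})` and `ξ′ := Σ_b ψ(b) σ_b(i_M · x′_{n+2,∅})` (the values of GEN 20's layer eigenfunctional on the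
lift `y` of `z(f_W)` resp. on the transported lift `ỹ` of `z(f′)`, up to `[ℚ(μ_M):ℚ_n] = 2` and a `2`-adic embedding; companion
file `IwasawaH1LayerEigenfunctionalTwistZetaTwoProofs`). Then:
* `ι(σ_b i_M) = χ₄(b)·I` (`i_M^4 = 1`, `σ_b(μ) = μ^b`), so `ι(ξ′) = I · Σ_b (ψ_ℂχ₄)(b) ι(σ_b x′)` — the character sum of `x′` at the
  ODD character `ψ_ℂ·χ₄` (`embed_sigma_eq_chiFour_mul_I`, `charSum_twist_eq`);
* the `(2A·M)`-depleted twisted series agree: `Σ (ψ_ℂχ₄)(n) a_n(f′) n^{-s} = Σ ψ_ℂ(n) a_n(f_W) n^{-s}` since `a_n(f′) = χ₄(n)a_n(f_W)`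
  for odd `n` (`Automorphic.IsNewformOf.cuspCoeff_quadraticTwist_neg_one_of_odd`) and both characters kill even `n`
  (`isDepletedTwistedL_twist_of`); so ONE entire continuation `L` serves both value laws (C5);
* (C5) for `W` (even clause): `ι(ξ) = κ·L(1)/Ω⁺_f·R⁻`, `R⁻ = [a/A]⁻_f·cd(c − ψ̄(c))(d − ψ̄(d))` (Kato's datum, `c ≡ d ≡ 1 (A)`);
  (C5) for `W′` (odd clause): `Σ_b (ψ_ℂχ₄)(b) ι(σ_b x′) = −κ′·L(1)/(IΩ⁻_{f′})·R⁺`, `R⁺ = [a′/A]⁺_{f′}·cd(c − ψ̄(c))(d − ψ̄(d))` — the SAME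
  character factor because `χ₄(c) = χ₄(d) = 1` (`c ≡ d ≡ 1 (4)`, `cuspFactor_false_eq_of_dvd_sub_one`);
* hence **`C_W · ι(ξ′) = C_{W′} · ι(ξ)`** with the constants `C_W = κ[a/A]⁻_f/Ω⁺_f ≠ 0`, `C_{W′} = −κ′[a′/A]⁺_{f′}/Ω⁻_{f′} ≠ 0`
  INDEPENDENT of `n` and `ψ` (`embed_twistSum_mul_eq_embed_sum_mul_of_valueLaws` — the algebra of the two value laws at any level `4 ∣ M`;
  `embed_twistSum_mul_eq_embed_sum_mul` — at `p = 2` from the two `ZetaBody` witnesses): one period ratio, as the socket docstring says.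
Also: `exists_ratPlusSymbol_ne_zero` (a cusp with `[r]⁺_{f′} ≠ 0`, Manin–Drinfeld/Cremona `exists_re_cuspSymbol_ne_zero`) and
`exists_katoPairDatum` (ONE guarded datum `(c, d, A)` with `c ≡ d ≡ 1 (4A)`, `c, d > 1`, cusps `a/A`, `a′/A` with `[a/A]⁻_f ≠ 0`,
`[a′/A]⁺_{f′} ≠ 0`, serving both newforms' guards), `exists_embed_eq_I` (`i_M` exists when `4 ∣ M`).

References: K. Kato, Astérisque 295 (2004), Thm. 12.5 (1) pp. 221–222, Thm. 9.7 p. 189, Thm. 6.6 (1) p. 163, Lemma 13.10 (1) p. 230,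
Ex. 13.3 p. 225 [Kato2004Asterisque]; J. H. Silverman, *AEC* (2009) X.5 Cor. 5.4, Ex. 10.16 (`a_n(E^{(−1)}) = χ₄(n)a_n(E)`)
[SilvermanAEC2009]; B. Mazur, J. Tate, J. Teitelbaum, Invent. Math. 84 (1986) §I.8 [MazurTateTeitelbaum1986Invent]; J. E. Cremona,
*Algorithms for modular elliptic curves* (1997) §2.8 [CremonaAlgorithms1997].
-/

set_option autoImplicit false

noncomputable section

open scoped BigOperators NumberField TensorProduct MatrixGroups
open Field IsDedekindDomain CongruenceSubgroup
open Literature.NumberTheory.GaloisRepresentations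
open Literature.NumberTheory.EllipticCurves Literature.NumberTheory.EllipticCurves.ModularForms
open Literature.NumberTheory.EllipticCurves.Kato2004.EulerSystemValues Rat.HeightOneSpectrum

namespace Literature.NumberTheory.EllipticCurves.Kato2004

/-! ## §1 Kato's plus four-cusp factor on his own datum; a cusp with `[r]⁺ ≠ 0`; the pair datum -/

section PairDatum

variable {N : ℕ} [NeZero N] (f : CuspForm (Gamma0 N) 2)

/-- **The four cusps of Lemma 13.10 (1) agree modulo `ℤ` when `d′ = 1` and `c ≡ 1 (mod A)`** — PLUS version (odd characters):
`R⁺_χ̄(c, d, a, A, 1) = [a/A]⁺_f · (c²d² − cd²χ̄(c) − c²dχ̄(d) + cdχ̄(cd))` for ANY weight `χ̄ : ℤ → ℂ` (`[x + n]⁺ = [x]⁺`,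
`ratPlusSymbol_add_intCast_eq`). [cite: Kato2004Asterisque, Lemma 13.10 (1) (p. 230) and Thm. 6.6 (1) (p. 163)] -/
theorem cuspFactor_false_eq_of_dvd_sub_one (χbar : ℤ → ℂ) {c d a : ℤ} {A : ℕ} (hA : 0 < A) (hcA : (A : ℤ) ∣ c - 1) :
    cuspFactor f false χbar c d a A 1 =
      ((ratPlusSymbol f ((a : ℚ) / A) : ℚ) : ℂ) *
        ((c : ℂ) ^ 2 * (d : ℂ) ^ 2 - (c : ℂ) * (d : ℂ) ^ 2 * χbar c - (c : ℂ) ^ 2 * (d : ℂ) * χbar d +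
          (c : ℂ) * (d : ℂ) * χbar (c * d)) := by
  obtain ⟨k, hk⟩ := hcA
  have hAq : ((A : ℕ) : ℚ) ≠ 0 := by exact_mod_cast hA.ne'
  have hc : (c : ℚ) = 1 + (A : ℚ) * k := by
    exact_mod_cast (show c = 1 + (A : ℤ) * k by linear_combination hk)
  have h2 : ((a * c : ℚ) / A) = (a : ℚ) / A + ((a * k : ℤ) : ℚ) := by
    rw [hc]; push_cast; field_simp
  have h3 : ((a * (1 : ℤ) : ℚ) / A) = (a : ℚ) / A := by rw [Int.cast_one, mul_one]
  have h4 : ((a * c * (1 : ℤ) : ℚ) / A) = (a : ℚ) / A + ((a * k : ℤ) : ℚ) := by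
    rw [Int.cast_one, mul_one]; exact h2
  have e : cuspFactor f false χbar c d a A 1 =
      ((c : ℂ) ^ 2 * (d : ℂ) ^ 2) * ((ratPlusSymbol f ((a : ℚ) / A) : ℚ) : ℂ)
        - ((c : ℂ) * (d : ℂ) ^ 2) * χbar c * ((ratPlusSymbol f ((a * c : ℚ) / A) : ℚ) : ℂ)
        - ((c : ℂ) ^ 2 * (d : ℂ)) * χbar d * ((ratPlusSymbol f ((a * (1 : ℤ) : ℚ) / A) : ℚ) : ℂ)
        + ((c : ℂ) * (d : ℂ)) * χbar (c * d) *
            ((ratPlusSymbol f ((a * c * (1 : ℤ) : ℚ) / A) : ℚ) : ℂ) := rfl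
  rw [e, h2, h3, h4, ratPlusSymbol_add_intCast_eq]
  ring

/-- **A rational newform has a cusp with non-zero rational PLUS symbol**: for a normalised newform `f ∈ S₂(Γ₀(N))` with `K_f = ℚ`
there is `r ∈ ℚ` with `[r]⁺_f ≠ 0` (some period `{∞, γ∞}_f` has non-zero REAL part, `exists_re_cuspSymbol_ne_zero` — Cremona's
real period exists; `[r]⁺_f · Ω⁺_f = plusSymbol f r = Re{∞, r}_f` for real coefficients). The plus twin of
`exists_ratMinusSymbol_ne_zero`. [cite: CremonaAlgorithms1997, §2.8] [cite: MazurTateTeitelbaum1986Invent, §I.8] -/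
theorem exists_ratPlusSymbol_ne_zero (hf : IsNewform0 f) (hQ : coeffField f = ⊥) : ∃ r : ℚ, ratPlusSymbol f r ≠ 0 := by
  obtain ⟨γ, hγ⟩ := exists_re_cuspSymbol_ne_zero f hf.ne_zero
  by_cases hc : (γ : SL(2, ℤ)) 1 0 = 0
  · exact absurd (by simp [cuspSymbol, hc]) hγ
  · have hms : cuspSymbol f γ = modularSymbol f ((((γ : SL(2, ℤ)) 0 0 : ℤ) : ℚ) / (((γ : SL(2, ℤ)) 1 0 : ℤ) : ℚ)) := by
      simp [cuspSymbol, hc]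
    refine ⟨(((γ : SL(2, ℤ)) 0 0 : ℤ) : ℚ) / (((γ : SL(2, ℤ)) 1 0 : ℤ) : ℚ), fun h0 => hγ ?_⟩
    set r : ℚ := (((γ : SL(2, ℤ)) 0 0 : ℤ) : ℚ) / (((γ : SL(2, ℤ)) 1 0 : ℤ) : ℚ)
    have hreal : ∀ n, (cuspCoeff f n).im = 0 := cuspCoeff_im_eq_zero_of_coeffField_eq_bot hQ
    have hplus : plusSymbol f r = ((modularSymbol f r).re : ℂ) :=
      plusSymbol_eq_re_of f (modularSymbol_neg_eq_conj_holds f) hreal r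
    have hprod := ratCast_ratPlusSymbol_mul_plusPeriod f hf hQ r
    rw [h0, Rat.cast_zero, zero_mul] at hprod
    have hre : ((modularSymbol f r).re : ℂ) = 0 := by rw [← hplus, ← hprod]
    rw [hms]
    exact_mod_cast hre

/-- **Kato's guarded datum for a PAIR of rational newforms** `f ∈ S₂(Γ₀(N))`, `f′ ∈ S₂(Γ₀(N′))` at the prime `p`: ONE `A ≥ 1` with
`4 ∣ A`, cusps `a/A`, `a′/A` with `[a/A]⁻_f ≠ 0` and `[a′/A]⁺_{f′} ≠ 0` (common denominator of `exists_ratMinusSymbol_ne_zero` for `f` and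
`exists_ratPlusSymbol_ne_zero` for `f′`), `c = 1 + 6pA`, `d = 1 + 6pANN′` — so `(c, 6pA) = (d, 6pN) = (d, 6pN′) = 1` (Ex. 13.3 for both
newforms), `c ≡ d ≡ 1 (mod A)`, hence `c ≡ d ≡ 1 (mod 4)`, and `c, d > 1`.
[cite: Kato2004Asterisque, Ex. 13.3 (p. 225) and 13.9 (p. 229)] -/
theorem exists_katoPairDatum (hf : IsNewform0 f) (hQ : coeffField f = ⊥) {N' : ℕ} [NeZero N'] (f' : CuspForm (Gamma0 N') 2)
    (hf' : IsNewform0 f') (hQ' : coeffField f' = ⊥) (p : ℕ) [hp : Fact p.Prime] :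
    ∃ (c d a a' : ℤ) (A : ℕ), 0 < A ∧ Int.gcd c (6 * p * A) = 1 ∧ Int.gcd d (6 * p * N) = 1 ∧ Int.gcd d (6 * p * N') = 1 ∧
      (A : ℤ) ∣ c - 1 ∧ (A : ℤ) ∣ d - 1 ∧ (4 : ℤ) ∣ c - 1 ∧ (4 : ℤ) ∣ d - 1 ∧ 1 < c ∧ 1 < d ∧
      ratMinusSymbol f ((a : ℚ) / A) ≠ 0 ∧ ratPlusSymbol f' ((a' : ℚ) / A) ≠ 0 := by
  obtain ⟨r, hr⟩ := exists_ratMinusSymbol_ne_zero f hf hQ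
  obtain ⟨r', hr'⟩ := exists_ratPlusSymbol_ne_zero f' hf' hQ'
  -- common denominator `A = 4 · den r · den r′`
  set A : ℕ := 4 * r.den * r'.den with hAdef
  have hA : 0 < A := by rw [hAdef]; exact Nat.mul_pos (Nat.mul_pos (by norm_num) r.den_pos) r'.den_pos
  have hp1 : 1 ≤ (p : ℤ) := by exact_mod_cast hp.out.one_lt.le
  have hA1 : 1 ≤ (A : ℤ) := by exact_mod_cast hA
  have hN1 : 1 ≤ (N : ℤ) := by exact_mod_cast Nat.pos_of_ne_zero (NeZero.ne N)
  have hN'1 : 1 ≤ (N' : ℤ) := by exact_mod_cast Nat.pos_of_ne_zero (NeZero.ne N')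
  have hpos₁ : (0 : ℤ) < 6 * p * A := by positivity
  have hpos₂ : (0 : ℤ) < 6 * p * A * N * N' := by positivity
  -- the cusps over `A`: `a = num r · 4 den r′`, `a′ = num r′ · 4 den r`
  have hra : ((r.num * (4 * r'.den) : ℤ) : ℚ) / A = r := by
    rw [hAdef]; push_cast
    have hd : (r.den : ℚ) ≠ 0 := by exact_mod_cast r.den_pos.ne'
    have hd' : (r'.den : ℚ) ≠ 0 := by exact_mod_cast r'.den_pos.ne'
    rw [show (r.num : ℚ) * (4 * (r'.den : ℚ)) / (4 * (r.den : ℚ) * (r'.den : ℚ)) = (r.num : ℚ) / r.den by field_simp]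
    exact r.num_div_den
  have hra' : ((r'.num * (4 * r.den) : ℤ) : ℚ) / A = r' := by
    rw [hAdef]; push_cast
    have hd : (r.den : ℚ) ≠ 0 := by exact_mod_cast r.den_pos.ne'
    have hd' : (r'.den : ℚ) ≠ 0 := by exact_mod_cast r'.den_pos.ne'
    rw [show (r'.num : ℚ) * (4 * (r.den : ℚ)) / (4 * (r.den : ℚ) * (r'.den : ℚ)) = (r'.num : ℚ) / r'.den by field_simp]
    exact r'.num_div_den
  have h4A : (4 : ℤ) ∣ (A : ℤ) := ⟨r.den * r'.den, by rw [hAdef]; push_cast; ring⟩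
  refine ⟨1 + 6 * p * A, 1 + 6 * p * A * N * N', r.num * (4 * r'.den), r'.num * (4 * r.den), A, hA,
    ?_, ?_, ?_, ?_, ?_, ?_, ?_, ?_, ?_, ?_, ?_⟩
  · rw [← Int.isCoprime_iff_gcd_eq_one]; exact ⟨1, -1, by ring⟩
  · rw [← Int.isCoprime_iff_gcd_eq_one]; exact ⟨1, -((A : ℤ) * N'), by ring⟩
  · rw [← Int.isCoprime_iff_gcd_eq_one]; exact ⟨1, -((A : ℤ) * N), by ring⟩
  · exact ⟨6 * p, by ring⟩
  · exact ⟨6 * p * N * N', by ring⟩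
  · obtain ⟨q, hq⟩ := h4A
    exact ⟨6 * p * q, by linear_combination (6 * (p : ℤ)) * hq⟩
  · obtain ⟨q, hq⟩ := h4A
    exact ⟨6 * p * q * N * N', by linear_combination (6 * (p : ℤ) * N * N') * hq⟩
  · linarith
  · linarith
  · rwa [hra]
  · rwa [hra']

end PairDatum

/-! ## §2 The twisted `L`-series: `L_{(2AM)}(f′, ψχ₄, s) = L_{(2AM)}(f_W, ψ, s)` -/

section TwistedSeries

variable {N N' : ℕ} [NeZero N] [NeZero N'] {W : WeierstrassCurve ℚ} [W.IsElliptic]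
  {f : CuspForm (Gamma0 N) 2} {f' : CuspForm (Gamma0 N') 2}

/-- The complex character `χ₄` lifted to an even modulus `M` with `4 ∣ M`: its value at the class of a natural number `n` coprime to
`M` is `χ₄(n)`. [folklore] -/
private theorem changeLevel_chiFour_apply_natCast {M : ℕ} [NeZero M] (h4 : 4 ∣ M) {n : ℕ} (hn : IsUnit (n : ZMod M)) :
    DirichletCharacter.changeLevel h4 (ZMod.χ₄.ringHomComp (Int.castRingHom ℂ)) (n : ZMod M) = (ZMod.χ₄ n : ℂ) := by
  obtain ⟨u, hu⟩ := hn
  rw [← hu, DirichletCharacter.changeLevel_eq_cast_of_dvd _ h4 u, hu, ZMod.cast_natCast h4, MulChar.ringHomComp_apply]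
  rfl

/-- **The depleted twisted series of `f′` by `ψ·χ₄` is the depleted twisted series of `f_W` by `ψ`** (`W′ = W^{(−1)}`, `f`, `f′` the
newforms; `4 ∣ M`): an entire continuation `L` of `Σ_{(n, 2AM)=1} ψ(n) a_n(f) n^{-s}` is one of `Σ_{(n,2AM)=1} (ψχ₄)(n) a_n(f′) n^{-s}`,
because the two Dirichlet series coincide term by term — for `n` prime to `2AM` (odd) `a_n(f′) = χ₄(n) a_n(f)`
(`IsNewformOf.cuspCoeff_quadraticTwist_neg_one_of_odd`) and `χ₄(n)² = 1`; for the other `n` both characters vanish.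
[cite: SilvermanAEC2009, X.5 Cor. 5.4 and Exercise 10.16] [cite: Kato2004Asterisque, §6.2 (p. 161)] -/
theorem isDepletedTwistedL_twist_of (hf : IsNewformOf W f) (hf' : IsNewformOf (W.quadraticTwist (-1)) f') {M : ℕ} [NeZero M]
    (h4 : 4 ∣ M) (B : ℕ) [NeZero (M * B)] (ψ : DirichletCharacter ℂ M) {L : ℂ → ℂ} (hL : IsDepletedTwistedL f M B ψ L) :
    IsDepletedTwistedL f' M B (ψ * DirichletCharacter.changeLevel h4 (ZMod.χ₄.ringHomComp (Int.castRingHom ℂ))) L := by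
  refine ⟨hL.1, fun s hs ↦ ?_⟩
  rw [hL.2 s hs]
  unfold twistedLSeries
  congr 1
  funext n
  set ω : DirichletCharacter ℂ M := DirichletCharacter.changeLevel h4 (ZMod.χ₄.ringHomComp (Int.castRingHom ℂ)) with hω
  by_cases hu : IsUnit ((n : ℕ) : ZMod (M * B))
  · -- `n` prime to `M·B`: odd, and the characters are evaluated at the class of `n` mod `M`
    have hcop : n.Coprime (M * B) := (ZMod.isUnit_iff_coprime n (M * B)).mp hu
    have h2M : 2 ∣ M * B := (show (2 : ℕ) ∣ 4 by norm_num).trans (h4.trans (dvd_mul_right M B))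
    have hodd : ¬ 2 ∣ n := fun h2 ↦ by
      have := Nat.Coprime.coprime_dvd_left h2 hcop
      exact absurd (Nat.Coprime.eq_one_of_dvd this h2M) (by norm_num)
    have huM : IsUnit ((n : ℕ) : ZMod M) := (ZMod.isUnit_iff_coprime n M).mpr (hcop.coprime_dvd_right (dvd_mul_right M B))
    obtain ⟨v, hv⟩ := hu
    have hcl : ∀ χ : DirichletCharacter ℂ M, DirichletCharacter.changeLevel (dvd_mul_right M B) χ (n : ZMod (M * B)) =
        χ (n : ZMod M) := fun χ ↦ by
      rw [← hv, DirichletCharacter.changeLevel_eq_cast_of_dvd χ (dvd_mul_right M B) v, hv,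
        ZMod.cast_natCast (dvd_mul_right M B)]
    rw [hcl, hcl, MulChar.mul_apply, hω, changeLevel_chiFour_apply_natCast h4 huM,
      Literature.NumberTheory.Automorphic.IsNewformOf.cuspCoeff_quadraticTwist_neg_one_of_odd hf hf' hodd]
    have hsq : ((ZMod.χ₄ n : ℤ) : ℂ) * ((ZMod.χ₄ n : ℤ) : ℂ) = 1 := by
      have := Literature.NumberTheory.Automorphic.χ₄_sq_eq_one_of_odd hodd
      rw [sq] at this
      exact_mod_cast this
    linear_combination (-(ψ (n : ZMod M) * cuspCoeff f n)) * hsq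
  · -- `n` not prime to `M·B`: both characters vanish
    rw [MulChar.map_nonunit _ hu, MulChar.map_nonunit _ hu, zero_mul, zero_mul]

end TwistedSeries

/-! ## §3 The twist element `i_M` and the character sums of `i_M · x′` -/

section TwistElement

variable {M : ℕ} [NeZero M] (ιM : CyclotomicField M ℚ →+* ℂ)

set_option backward.isDefEq.respectTransparency false in
/-- For `4 ∣ M` there is `i_M ∈ ℚ(ζ_M)` with `ι(i_M) = I`: `I` is an `M`-th root of unity of `ℂ`, and the embedding of a primitive `M`-th
root of unity of `ℚ(ζ_M)` hits every `M`-th root of unity of `ℂ`. [cite: Washington1997, Ch. 2] -/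
theorem exists_embed_eq_I (h4 : 4 ∣ M) : ∃ i : CyclotomicField M ℚ, ιM i = Complex.I := by
  have hζ := IsCyclotomicExtension.zeta_spec M ℚ (CyclotomicField M ℚ)
  have hζC : IsPrimitiveRoot (ιM (IsCyclotomicExtension.zeta M ℚ (CyclotomicField M ℚ))) M := hζ.map_of_injective ιM.injective
  have hI : Complex.I ^ M = 1 := by
    obtain ⟨q, hq⟩ := h4
    have : Complex.I ^ (4 * q) = 1 := by rw [pow_mul, Complex.I_pow_four, one_pow]
    rwa [← hq] at this
  obtain ⟨j, -, hj⟩ := hζC.eq_pow_of_pow_eq_one hI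
  exact ⟨IsCyclotomicExtension.zeta M ℚ (CyclotomicField M ℚ) ^ j, by rw [map_pow, hj]⟩

set_option backward.isDefEq.respectTransparency false in
/-- **`ι(σ_b i_M) = χ₄(b) · I`**: `σ_b` raises the roots of unity to the `b`-th power (`sigma_apply_of_pow_eq_one`, `i_M^M = 1`), `I^b`
for odd `b` is `I` or `−I` according to `b ≡ 1, 3 (mod 4)`, i.e. `χ₄(b)·I`. [cite: Kato2004Asterisque, (5.7.1) (p. 157)] -/
theorem embed_sigma_eq_chiFour_mul_I (h4 : 4 ∣ M) {i : CyclotomicField M ℚ} (hi : ιM i = Complex.I) (b : (ZMod M)ˣ) :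
    ιM (sigma M b i) = (ZMod.χ₄ (b : ZMod M).val : ℂ) * Complex.I := by
  have hi4 : i ^ 4 = 1 := ιM.injective (by rw [map_pow, hi, Complex.I_pow_four, map_one])
  have hiM : i ^ M = 1 := by
    obtain ⟨q, hq⟩ := h4
    have : i ^ (4 * q) = 1 := by rw [pow_mul, hi4, one_pow]
    rwa [← hq] at this
  rw [sigma_apply_of_pow_eq_one M b i hiM, map_pow, hi]
  -- `val b` is odd (`b` a unit, `M` even)
  set k : ℕ := (b : ZMod M).val with hk
  have hcop : k.Coprime M := by rw [hk]; exact ZMod.val_coe_unit_coprime b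
  have hodd : k % 2 = 1 := by
    have h2M : 2 ∣ M := (show (2 : ℕ) ∣ 4 by norm_num).trans h4
    by_contra h
    have h2k : 2 ∣ k := Nat.dvd_of_mod_eq_zero (by omega)
    exact absurd (Nat.Coprime.eq_one_of_dvd (Nat.Coprime.coprime_dvd_left h2k hcop) h2M) (by norm_num)
  rw [← Nat.div_add_mod k 4, pow_add, pow_mul, Complex.I_pow_four, one_pow, one_mul, ZMod.χ₄_nat_eq_if_mod_four]
  have hk4 : (4 * (k / 4) + k % 4) % 4 = k % 4 := by omega
  have hk2 : (4 * (k / 4) + k % 4) % 2 = 1 := by omega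
  rw [hk2, if_neg (by norm_num), hk4]
  have hcases : k % 4 = 1 ∨ k % 4 = 3 := by omega
  rcases hcases with h1 | h3
  · rw [h1, if_pos rfl, pow_one, Int.cast_one, one_mul]
  · rw [h3, if_neg (by norm_num)]
    rw [pow_succ, Complex.I_sq]
    push_cast
    ring

set_option backward.isDefEq.respectTransparency false in
/-- **The character sum of `i_M · x′` at `ψ` is `I` times the character sum of `x′` at the ODD character `ψ·χ₄`**:
`Σ_b ψ_ℂ(b) ι(σ_b(i_M x′)) = I · Σ_b (ψ_ℂ·χ₄)(b) ι(σ_b x′)` (`σ_b` multiplicative, `embed_sigma_eq_chiFour_mul_I`).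
[cite: Kato2004Asterisque, Thm. 6.6 (1) (p. 163) and (5.7.1) (p. 157)] -/
theorem charSum_twist_eq (h4 : 4 ∣ M) {i : CyclotomicField M ℚ} (hi : ιM i = Complex.I) (ψ : DirichletCharacter ℂ M)
    (x' : CyclotomicField M ℚ) :
    ∑ b : (ZMod M)ˣ, ψ (b : ZMod M) * ιM (sigma M b (i * x')) =
      Complex.I * charSum M ιM (ψ * DirichletCharacter.changeLevel h4 (ZMod.χ₄.ringHomComp (Int.castRingHom ℂ))) x' := by
  unfold charSum
  rw [Finset.mul_sum]
  refine Finset.sum_congr rfl fun b _ ↦ ?_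
  have hbu : IsUnit ((b : ZMod M).val : ZMod M) := by
    rw [ZMod.natCast_zmod_val]; exact Units.isUnit b
  rw [map_mul, map_mul, embed_sigma_eq_chiFour_mul_I ιM h4 hi b, MulChar.mul_apply,
    ← ZMod.natCast_zmod_val (b : ZMod M), changeLevel_chiFour_apply_natCast h4 hbu, ZMod.natCast_zmod_val]
  ring

end TwistElement

/-! ## §4 The value comparison: `C_W · ι(ξ′) = C_{W′} · ι(ξ)` — abstract algebra of the two value laws, then at `p = 2` -/

section Algebra

variable {M : ℕ} [NeZero M] {N N' : ℕ} [NeZero N] [NeZero N'] (f : CuspForm (Gamma0 N) 2) (f' : CuspForm (Gamma0 N') 2)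

set_option maxHeartbeats 400000 in
set_option backward.isDefEq.respectTransparency false in
/-- **The algebra of the two value laws (Kato Thm. 6.6 (1) / 9.7 read on Kato's datum).** At a level `M` with `4 ∣ M`, an embedding
`ι_M`, `i_M` with `ι_M(i_M) = I`, an EVEN `ℚ(ζ_M)`-valued character `ψ` with complex shadow `ψ_ℂ = ψ ∘ ι_M`, elements `x, x′ ∈ ℚ(ζ_M)`
and ONE number `L₁ ∈ ℂ`: IF `Σ_b ψ_ℂ(b)ι(σ_b x) = κ·(L₁/Ω⁺_f)·R⁻_{ψ̄_ℂ}(c,d,a,A,1)` (even clause of (C5) for `f`) and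
`Σ_b (ψ_ℂχ₄)(b)ι(σ_b x′) = −κ′·(L₁/(IΩ⁻_{f′}))·R⁺_{(ψ_ℂχ₄)‾}(c,d,a′,A,1)` (odd clause for `f′`), with `c ≡ d ≡ 1 (mod A)` and `(mod 4)`,
`c, d` units mod `M`, `Ω⁺_f, Ω⁻_{f′} ≠ 0`, THEN
`(κ[a/A]⁻_f/Ω⁺_f) · ι(Σ_b ψ(b)σ_b(i_M x′)) = (−κ′[a′/A]⁺_{f′}/Ω⁻_{f′}) · ι(Σ_b ψ(b)σ_b x)`: both four-cusp factors collapse to the SAME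
character factor `cd(c − ψ̄(c))(d − ψ̄(d))` times `[a/A]⁻_f` resp. `[a′/A]⁺_{f′}` (`χ₄(c) = χ₄(d) = 1`), and `ι(σ_b i_M) = χ₄(b)I`.
[cite: Kato2004Asterisque, Thm. 6.6 (1) (p. 163), Lemma 13.10 (1) (p. 230), Thm. 12.5 (1) (pp. 221–222)] -/
theorem embed_twistSum_mul_eq_embed_sum_mul_of_valueLaws (h4 : 4 ∣ M) (ιM : CyclotomicField M ℚ →+* ℂ)
    {i : CyclotomicField M ℚ} (hi : ιM i = Complex.I) (ψ : DirichletCharacter (CyclotomicField M ℚ) M)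
    (ψC ω : DirichletCharacter ℂ M) (hψC : ψC = ψ.ringHomComp ιM)
    (hω : ω = DirichletCharacter.changeLevel h4 (ZMod.χ₄.ringHomComp (Int.castRingHom ℂ)))
    (xW xT : CyclotomicField M ℚ) {κ κ' : ℝ} {L₁ : ℂ} {c d a a' : ℤ} {A : ℕ} (hA : 0 < A) (hcA : (A : ℤ) ∣ c - 1)
    (hc4 : (4 : ℤ) ∣ c - 1) (hd4 : (4 : ℤ) ∣ d - 1) (hcM : IsUnit (c : ZMod M)) (hdM : IsUnit (d : ZMod M))
    (hΩ : (plusPeriod f : ℂ) ≠ 0) (hΩ' : (minusPeriod f' : ℂ) ≠ 0)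
    (h5W : charSum M ιM ψC xW =
      (κ : ℂ) * (L₁ / (plusPeriod f : ℂ)) * cuspFactor f true (fun k ↦ ψC⁻¹ (k : ZMod M)) c d a A 1)
    (h5T : charSum M ιM (ψC * ω) xT =
      -(κ' : ℂ) * (L₁ / (Complex.I * (minusPeriod f' : ℂ))) * cuspFactor f' false (fun k ↦ (ψC * ω)⁻¹ (k : ZMod M)) c d a' A 1) :
    ((κ : ℂ) * ((ratMinusSymbol f ((a : ℚ) / A) : ℚ) : ℂ) / (plusPeriod f : ℂ)) *
        ιM (∑ b : (ZMod M)ˣ, ψ (b : ZMod M) * sigma M b (i * xT)) =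
      (-(κ' : ℂ) * ((ratPlusSymbol f' ((a' : ℚ) / A) : ℚ) : ℂ) / (minusPeriod f' : ℂ)) *
        ιM (∑ b : (ZMod M)ˣ, ψ (b : ZMod M) * sigma M b xW) := by
  -- the two embedded sums are character sums
  have hsumW : ιM (∑ b : (ZMod M)ˣ, ψ (b : ZMod M) * sigma M b xW) = charSum M ιM ψC xW := by
    unfold charSum
    rw [map_sum]
    refine Finset.sum_congr rfl fun b _ ↦ ?_
    rw [map_mul, hψC, MulChar.ringHomComp_apply]
  have hsumT : ιM (∑ b : (ZMod M)ˣ, ψ (b : ZMod M) * sigma M b (i * xT)) = Complex.I * charSum M ιM (ψC * ω) xT := by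
    rw [map_sum, hω, ← charSum_twist_eq ιM h4 hi ψC xT]
    refine Finset.sum_congr rfl fun b _ ↦ ?_
    rw [map_mul, hψC, MulChar.ringHomComp_apply]
  -- the cusp factors on Kato's datum: the SAME character factor `cd (c − ψ̄(c)) (d − ψ̄(d))`
  have hω1 : ∀ {e : ℤ}, (4 : ℤ) ∣ e - 1 → IsUnit (e : ZMod M) → ω (e : ZMod M) = 1 := by
    intro e he heu
    obtain ⟨v, hv⟩ := heu
    rw [hω, ← hv, DirichletCharacter.changeLevel_eq_cast_of_dvd _ h4 v, hv, ZMod.cast_intCast h4, MulChar.ringHomComp_apply]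
    have h1 : (e : ZMod 4) = 1 := by
      obtain ⟨q, hq⟩ := he
      have : e = 4 * q + 1 := by linear_combination hq
      rw [this]; push_cast; rw [show (4 : ZMod 4) = 0 from by decide]; ring
    rw [h1, map_one, map_one]
  have hinvT : ∀ {e : ℤ}, (4 : ℤ) ∣ e - 1 → IsUnit (e : ZMod M) → (ψC * ω)⁻¹ (e : ZMod M) = ψC⁻¹ (e : ZMod M) := by
    intro e he heu
    rw [mul_inv, MulChar.mul_apply, MulChar.inv_apply_eq_inv' ω, hω1 he heu, inv_one, mul_one]
  have hRW : cuspFactor f true (fun k ↦ ψC⁻¹ (k : ZMod M)) c d a A 1 =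
      ((ratMinusSymbol f ((a : ℚ) / A) : ℚ) : ℂ) *
        ((c : ℂ) * (d : ℂ) * (((c : ℂ) - ψC⁻¹ (c : ZMod M)) * ((d : ℂ) - ψC⁻¹ (d : ZMod M)))) := by
    rw [cuspFactor_true_eq_of_dvd_sub_one f _ hA hcA, Int.cast_mul, map_mul]
    ring
  have hRT : cuspFactor f' false (fun k ↦ (ψC * ω)⁻¹ (k : ZMod M)) c d a' A 1 =
      ((ratPlusSymbol f' ((a' : ℚ) / A) : ℚ) : ℂ) *
        ((c : ℂ) * (d : ℂ) * (((c : ℂ) - ψC⁻¹ (c : ZMod M)) * ((d : ℂ) - ψC⁻¹ (d : ZMod M)))) := by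
    rw [cuspFactor_false_eq_of_dvd_sub_one f' _ hA hcA, Int.cast_mul, map_mul, hinvT hc4 hcM, hinvT hd4 hdM]
    ring
  -- assemble
  have hI : Complex.I ≠ 0 := Complex.I_ne_zero
  rw [hsumT, hsumW, h5W, h5T, hRW, hRT]
  field_simp

end Algebra

section PairValues

variable {W : WeierstrassCurve ℚ} [W.IsElliptic] [ContinuousSMul ℤ_[2] (W.tateModule 2)]
  [Module.Free ℤ_[2] (W.tateModule 2)] [Module.Finite ℤ_[2] (W.tateModule 2)]
  [(W.quadraticTwist (-1)).IsElliptic] [ContinuousSMul ℤ_[2] ((W.quadraticTwist (-1)).tateModule 2)]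
  [Module.Free ℤ_[2] ((W.quadraticTwist (-1)).tateModule 2)] [Module.Finite ℤ_[2] ((W.quadraticTwist (-1)).tateModule 2)]
  {N N' : ℕ} [NeZero N] [NeZero N']
  {f : CuspForm (Gamma0 N) 2} {f' : CuspForm (Gamma0 N') 2} {ι : (m : ℕ) → (CyclotomicField m ℚ →+* ℂ)} {κ κ' : ℝ}
  {Λ : ∀ (k : ℕ) (r : Finset (HeightOneSpectrum (𝓞 ℚ))),
    H1 (tateRep W 2) (cycSubgroup 2 k r) →ₗ[ℤ_[2]] ℚ_[2] ⊗[ℚ] CyclotomicField (cycLevel 2 k r) ℚ}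
  {Λ' : ∀ (k : ℕ) (r : Finset (HeightOneSpectrum (𝓞 ℚ))),
    H1 (tateRep (W.quadraticTwist (-1)) 2) (cycSubgroup 2 k r) →ₗ[ℤ_[2]] ℚ_[2] ⊗[ℚ] CyclotomicField (cycLevel 2 k r) ℚ}
  {c d a a' : ℤ} {A : ℕ}
  {z : ∀ (k : ℕ) (r : (cyclotomicLevelsRat 2 (badPlaces c d A N)).Ideals),
    H1 (tateRep W 2) ((cyclotomicLevelsRat 2 (badPlaces c d A N)).level k r.1)}
  {x : ∀ (k : ℕ) (r : (cyclotomicLevelsRat 2 (badPlaces c d A N)).Ideals), CyclotomicField (cycLevel 2 k r.1) ℚ}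
  {z' : ∀ (k : ℕ) (r : (cyclotomicLevelsRat 2 (badPlaces c d A N')).Ideals),
    H1 (tateRep (W.quadraticTwist (-1)) 2) ((cyclotomicLevelsRat 2 (badPlaces c d A N')).level k r.1)}
  {x' : ∀ (k : ℕ) (r : (cyclotomicLevelsRat 2 (badPlaces c d A N')).Ideals), CyclotomicField (cycLevel 2 k r.1) ℚ}

/-- `4 ∣ 2^{n+2} = cycLevel 2 (n+2) ∅`. [folklore] -/
private theorem four_dvd_cycLevel_two (n : ℕ) : 4 ∣ cycLevel 2 (n + 2) ∅ := by
  have hM : cycLevel 2 (n + 2) ∅ = 2 ^ (n + 2) := by simp [cycLevel]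
  rw [hM, pow_add]
  exact Dvd.intro_left _ rfl

set_option backward.isDefEq.respectTransparency false in
/-- **Kato Thm. 12.5 (1) for the pair `(f_W, f_{W′})` at one level, one even character: `C_W · ι(ξ′) = C_{W′} · ι(ξ)`.** Data: the
two `ZetaBody` witnesses at `p = 2` over ONE guarded datum (`(c,12A) = (d,12N) = (d,12N′) = 1`, `c ≡ d ≡ 1 (mod A)` and `(mod 4)`),
`f`, `f′` the newforms of `W`, `W′ = W^{(−1)}`; a level `M = 2^{n+2}`; `i_M` with `ι_M(i_M) = I`; an EVEN `ℚ(ζ_M)`-valued character `ψ`.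
With `ξ = Σ_b ψ(b)σ_b(x_{n+2,∅})`, `ξ′ = Σ_b ψ(b)σ_b(i_M·x′_{n+2,∅})`:
`(κ·[a/A]⁻_f/Ω⁺_f) · ι(ξ′) = (−κ′·[a′/A]⁺_{f′}/Ω⁻_{f′}) · ι(ξ)` — the two value laws (C5) (even clause for `W` at `ψ_ℂ`, odd clause for
`W′` at `ψ_ℂχ₄`) with ONE entire continuation of the common depleted series (`exists_differentiable_eq_twistedLSeries_holds`,
`isDepletedTwistedL_twist_of`), then `embed_twistSum_mul_eq_embed_sum_mul_of_valueLaws`. The constants do not depend on `n` or `ψ`: ONE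
period ratio. [cite: Kato2004Asterisque, Thm. 12.5 (1) (pp. 221–222), Thm. 9.7 (p. 189), Thm. 6.6 (1) (p. 163), Lemma 13.10 (1) (p. 230)]
[cite: SilvermanAEC2009, X.5 Cor. 5.4 and Exercise 10.16] -/
theorem embed_twistSum_mul_eq_embed_sum_mul (hbody : ZetaBody W 2 f ι κ Λ c d a A z x)
    (hbody' : ZetaBody (W.quadraticTwist (-1)) 2 f' ι κ' Λ' c d a' A z' x')
    (hf : IsNewformOf W f) (hf' : IsNewformOf (W.quadraticTwist (-1)) f') (hA : 0 < A)
    (hc : Int.gcd c (6 * 2 * A) = 1) (hd : Int.gcd d (6 * 2 * N) = 1) (hd' : Int.gcd d (6 * 2 * N') = 1)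
    (hcA : (A : ℤ) ∣ c - 1) (hdA : (A : ℤ) ∣ d - 1) (hc4 : (4 : ℤ) ∣ c - 1) (hd4 : (4 : ℤ) ∣ d - 1)
    (n : ℕ) {i : CyclotomicField (cycLevel 2 (n + 2) ∅) ℚ} (hi : ι (cycLevel 2 (n + 2) ∅) i = Complex.I)
    (ψ : DirichletCharacter (CyclotomicField (cycLevel 2 (n + 2) ∅) ℚ) (cycLevel 2 (n + 2) ∅)) (hψ : ψ.Even)
    (xT : CyclotomicField (cycLevel 2 (n + 2) ∅) ℚ) (hxT : xT = x' (n + 2) (cyclotomicLevelsRat 2 (badPlaces c d A N')).idealOne) :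
    ((κ : ℂ) * ((ratMinusSymbol f ((a : ℚ) / A) : ℚ) : ℂ) / (plusPeriod f : ℂ)) *
        ι (cycLevel 2 (n + 2) ∅) (∑ b : (ZMod (cycLevel 2 (n + 2) ∅))ˣ, ψ (b : ZMod (cycLevel 2 (n + 2) ∅)) *
          sigma (cycLevel 2 (n + 2) ∅) b (i * xT)) =
      (-(κ' : ℂ) * ((ratPlusSymbol f' ((a' : ℚ) / A) : ℚ) : ℂ) / (minusPeriod f' : ℂ)) *
        ι (cycLevel 2 (n + 2) ∅) (∑ b : (ZMod (cycLevel 2 (n + 2) ∅))ˣ, ψ (b : ZMod (cycLevel 2 (n + 2) ∅)) *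
          sigma (cycLevel 2 (n + 2) ∅) b (x (n + 2) (cyclotomicLevelsRat 2 (badPlaces c d A N)).idealOne)) := by
  subst hxT
  have hM : cycLevel 2 (n + 2) ∅ = 2 ^ (n + 2) := by simp [cycLevel]
  have h4 : 4 ∣ cycLevel 2 (n + 2) ∅ := four_dvd_cycLevel_two n
  have hψCe : (ψ.ringHomComp (ι (cycLevel 2 (n + 2) ∅))) (-1) = 1 :=
    (LayerCharacterTwo.even_ringHomComp_iff ψ (ι (cycLevel 2 (n + 2) ∅)).injective).mpr hψ
  have hωodd : DirichletCharacter.changeLevel h4 (ZMod.χ₄.ringHomComp (Int.castRingHom ℂ)) (-1) = -1 := by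
    rw [← Units.coe_neg_one, DirichletCharacter.changeLevel_eq_cast_of_dvd _ h4, Units.coe_neg_one, ZMod.cast_neg h4,
      ZMod.cast_one h4]
    exact χ₄_ringHomComp_neg_one
  have hψωodd : (ψ.ringHomComp (ι (cycLevel 2 (n + 2) ∅)) *
      DirichletCharacter.changeLevel h4 (ZMod.χ₄.ringHomComp (Int.castRingHom ℂ))) (-1) = -1 := by
    rw [MulChar.mul_apply, hψCe, hωodd, one_mul]
  -- one entire continuation for both depleted series
  haveI : NeZero (cycLevel 2 (n + 2) ∅ * (2 * A)) := ⟨mul_ne_zero (NeZero.ne _) (mul_ne_zero two_ne_zero hA.ne')⟩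
  obtain ⟨L, hLd, hLs⟩ := exists_differentiable_eq_twistedLSeries_holds f (m := cycLevel 2 (n + 2) ∅ * (2 * A))
    (DirichletCharacter.changeLevel (dvd_mul_right (cycLevel 2 (n + 2) ∅) (2 * A)) (ψ.ringHomComp (ι (cycLevel 2 (n + 2) ∅))))
  have hdepW : IsDepletedTwistedL f (cycLevel 2 (n + 2) ∅) (2 * A) (ψ.ringHomComp (ι (cycLevel 2 (n + 2) ∅))) L := ⟨hLd, hLs⟩
  have hdepT := isDepletedTwistedL_twist_of hf hf' h4 (2 * A) (ψ.ringHomComp (ι (cycLevel 2 (n + 2) ∅))) hdepW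
  -- the guards of (C5)
  have hdd' : d * 1 ≡ 1 [ZMOD (A : ℤ)] := by
    rw [mul_one, Int.modEq_iff_dvd]
    obtain ⟨k, hk⟩ := hdA
    exact ⟨-k, by linear_combination -hk⟩
  have hcdW := gcd_mul_cycLevel_mul_eq_one_of_guards (p := 2) (N := N) hc hd hdd' (n + 1)
  have hcdT := gcd_mul_cycLevel_mul_eq_one_of_guards (p := 2) (N := N') hc hd' hdd' (n + 1)
  -- (C5) for `W` at the even `ψ_ℂ` and for `W′` at the odd `ψ_ℂ·χ₄`
  have h5W := ((hbody.2.2.2.2.2) (n + 2) (cyclotomicLevelsRat 2 (badPlaces c d A N)).idealOne 1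
    (ψ.ringHomComp (ι (cycLevel 2 (n + 2) ∅))) L hcdW hdd' hdepW).1 hψCe
  have h5T := ((hbody'.2.2.2.2.2) (n + 2) (cyclotomicLevelsRat 2 (badPlaces c d A N')).idealOne 1 _ L hcdT hdd' hdepT).2 hψωodd
  have hΩ : (plusPeriod f : ℂ) ≠ 0 := by exact_mod_cast (IsNewform0.plusPeriod_pos_holds hf.1 hf.coeffField_eq_bot).ne'
  have hΩ' : (minusPeriod f' : ℂ) ≠ 0 := by
    exact_mod_cast (IsNewform0.minusPeriod_pos_holds hf'.1 hf'.coeffField_eq_bot).ne'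
  exact embed_twistSum_mul_eq_embed_sum_mul_of_valueLaws f f' h4 (ι (cycLevel 2 (n + 2) ∅)) hi ψ _ _ rfl rfl _ _ hA hcA
    hc4 hd4 (isUnit_intCast_zmod_of_gcd_eq_one hc n hM) (isUnit_intCast_zmod_of_gcd_eq_one hd n hM) hΩ hΩ' h5W h5T

end PairValues

end Literature.NumberTheory.EllipticCurves.Kato2004

end
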